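import Summits.NavierStokesRegularity.NavierStokesRegularity.Theorems.ScenarioCensusRowF1ScalingTop
import HarnessLib

/-!
# LINE 40 «scaling-top» port, part 2/4: §4b the closed-subgroup dichotomy and the DSS pair (`forall_of_irrational_ratio`, `scaleInvariant_of_two`, KD `eq_zero_of_dssPair`), homogeneous slices
# (`hom_allScales`, KH `eq_zero_of_homogeneous` via the tree's homogeneous-slice door); limits with a MOVING APEX, the three defects and the three LEVELS
# (`similar_limit` / `dss_limit` / `hom_limit`, `exists_similarLevel` / `exists_dssLevel` / `exists_homLevel`)

Re-homed for the scenario census (typer seat ns-census-typer-1 g10; the cells «similar-pocket snapshots» / F1ds / F1hs and the floors SSF / DSF / HF are MEMBERS OF RECORD «DECIDED IN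
KERNEL IN FILES» of row F1 (item 85: critic idea-crit-3 g10 PASS no price tier B 12:32:22Z; ref PRE-CHECK ✓ §19.17; lead label); this port makes them TREE-decided): VERBATIM PORT of
ns-idea-3 LINE 40 «scaling-top», `pub/ideators/ns-idea-3/lines/scaling-top/line-scaling-top.lean` sha16 3435a148b4d1d87d (1360 l., lean check rc 0, 0 sorry), split for the 400-line
rule into `ScenarioCensusRowF1ScalingTop` (§1–§4a) → `…ScalingTopKill` (§4b) → `…ScalingTopFloors` (§5) → `…ScalingTopRows` (§6–§7 + census KEYS).  Lean text VERBATIM in namespace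
`…Theorems.ScenarioCensus.ScalingTop` (the line's `…Cruxes.ScenarioCensusRowF1.ScalingTopLine` re-homed); port edits: the frame restated VERBATIM by the line from LINES 34–39 (`topSet`,
`HasTypeIConstant`, `snapLevel`, `exists_fast_at`, `sqrt_mul_sq_mul`, `limitClass_compact`, `exists_level_of_limitKill`, `exists_witnessZoom_package`, `zoom_units`,
`eventually_forall_not_of_not_frequently`) is taken BY NAME from the landed two-time-top / one-level-top / snapshot-top / needle-top / echo-top ports, and the alias `centre_mem` is the tree's `IsTypeIAncientMild.comp_add_right` (Literature, BY NAME); the bookkeeping lemma `tendstoLocallyUniformly_comp_of_tendsto` (a twin of a landed lemma in a route-cone module) is not re-declared, its 3-line proof is inlined in `tendsto_eval`; `rowF1ss_holds` is spelled `: ScalingTop.Row_F1ss` (same statement; the unqualified text coincides with «stretched-top»'s `rowF1ss_holds`); `@[conjecture]` on the residual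
`SimilarCollapse` (≡ `ScenarioCensus.Row_F1`, OPEN); one-line docstrings added where missing (gate lint).  Statements untouched; the line's row keeps its name `ScalingTop.Row_F1ss`,
only its census KEY is spelled `Row_F1sps` because `ScenarioCensus.Row_F1ss` is «stretched-top»'s cell F1ss (slot 9, `ScenarioCensusRowF1StretchedTop.lean` :231).

No census VALUE is moved here (row F1 stays OPEN-WITH-LINE; the members become TREE-decided by name); NS regularity is NOT proved; `Row_F1` is untouched (zero
movement, `similarCollapse_iff_rowF1`); no summit statement is proved by this file. Lemmas that restate already-landed tree declarations are taken BY NAME (gate lint `dedup.landed`): `topSet` = `TwoTimeTop.topSet`, `HasTypeIConstant` = `OneLevelTop.HasTypeIConstant`, `snapLevel` = `SnapshotTop.snapLevel`, `exists_fast_at` = `SnapshotTop.exists_fast_at`, `sqrt_mul_sq_mul` = `SnapshotTop.sqrt_mul_sq_mul`, `limitClass_compact` = `NeedleTop.limitClass_compact`, `exists_level_of_limitKill` = `NeedleTop.exists_level_of_limitKill`, `zoom_units` = `NeedleTop.zoom_units`, `exists_witnessZoom_package` = `EchoTop.exists_witnessZoom_package`, `eventually_forall_not_of_not_frequently` = `EchoTop.eventually_forall_not_of_not_frequently`,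 `centre_mem` = `IsTypeIAncientMild.comp_add_right`.
-/

-- the summit and its single problem share the name `NavierStokesRegularity` (D-0017 nested layout)
set_option linter.dupNamespace false

noncomputable section

open MeasureTheory Set Function Filter TopologicalSpace Metric
open scoped Topology NNReal ENNReal InnerProductSpace

namespace Summit.NavierStokesRegularity.NavierStokesRegularity.Theorems.ScenarioCensus.ScalingTop

open Literature.Analysis Literature.Analysis.FluidPDE
open Summit.NavierStokesRegularity.NavierStokesRegularity.Theorems
open Summit.NavierStokesRegularity.NavierStokesRegularity.Theses
open Summit.NavierStokesRegularity.NavierStokesRegularity.Theorems.LocalHelicityTubeDoorFrobeniusProfileRigidityHelicalSlice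

/-- **Closed-subgroup dichotomy** (clone of the tree's `addSubgroup_eq_top_of_irrational_angle` with `2π` replaced by a second
generator): a closed predicate on `ℝ` stable under `0, +, −` and holding at `θ₁, θ₂` with `θ₁ / θ₂` irrational holds EVERYWHERE
(`AddSubgroup.dense_or_cyclic`). -/
theorem forall_of_irrational_ratio {P : ℝ → Prop} (h0 : P 0) (hadd : ∀ a b, P a → P b → P (a + b))
    (hneg : ∀ a, P a → P (-a)) (hclosed : IsClosed {a | P a}) {θ₁ θ₂ : ℝ} (hθ₁ : P θ₁) (hθ₂ : P θ₂)
    (hirr : Irrational (θ₁ / θ₂)) : ∀ a, P a := by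
  have hθ₂0 : θ₂ ≠ 0 := by
    rintro rfl
    exact hirr ⟨0, by simp⟩
  let S : AddSubgroup ℝ :=
    { carrier := {a | P a}
      add_mem' := fun {a b} ha hb => hadd a b ha hb
      zero_mem' := h0
      neg_mem' := fun {a} ha => hneg a ha }
  have hS : (S : Set ℝ) = {a | P a} := rfl
  suffices htop : (S : Set ℝ) = univ by
    intro a
    have : a ∈ (S : Set ℝ) := by rw [htop]; exact mem_univ a
    exact this
  rcases S.dense_or_cyclic with hd | ⟨g, hg⟩
  · have h1 : closure (S : Set ℝ) = univ := hd.closure_eq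
    rwa [(hS ▸ hclosed : IsClosed (S : Set ℝ)).closure_eq] at h1
  · exfalso
    have h₁ : θ₁ ∈ AddSubgroup.closure {g} := by rw [← hg]; exact hθ₁
    have h₂ : θ₂ ∈ AddSubgroup.closure {g} := by rw [← hg]; exact hθ₂
    obtain ⟨m, hm⟩ := AddSubgroup.mem_closure_singleton.1 h₁
    obtain ⟨n, hn⟩ := AddSubgroup.mem_closure_singleton.1 h₂
    have hn0 : (n : ℝ) ≠ 0 := by
      intro hn0
      apply hθ₂0
      rw [← hn, zsmul_eq_mul, hn0, zero_mul]
    have hg0 : g ≠ 0 := by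
      intro hg0
      apply hθ₂0
      rw [← hn, hg0, smul_zero]
    refine hirr ⟨(m : ℚ) / (n : ℚ), ?_⟩
    rw [← hm, ← hn, zsmul_eq_mul, zsmul_eq_mul]
    push_cast
    field_simp

/-- **Two incommensurable factors ⇒ all factors.**  If `W` (continuous on the open past) is DSS with factors `λ, λ' > 0` and
`log λ / log λ'` is irrational, then `W` is backward self-similar: `μ • W(μ² s, μ•y) = W(s, y)` for every `μ > 0`. -/
theorem scaleInvariant_of_two {M : ℝ} {W : ℝ → E3 → E3} (hW : IsTypeIAncientMild M W) {lam lam' : ℝ} (hlam : 0 < lam)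
    (hlam' : 0 < lam') (hirr : Irrational (Real.log lam / Real.log lam'))
    (h : ∀ s < 0, ∀ w : E3, W s w = lam • W (lam ^ 2 * s) (lam • w))
    (h' : ∀ s < 0, ∀ w : E3, W s w = lam' • W (lam' ^ 2 * s) (lam' • w)) :
    ∀ μ : ℝ, 0 < μ → ∀ s < 0, ∀ y : E3, μ • W (μ ^ 2 * s) (μ • y) = W s y := by
  have key : ∀ a : ℝ, ∀ s < 0, ∀ y : E3,
      W s y = Real.exp a • W (Real.exp a ^ 2 * s) (Real.exp a • y) := by
    refine forall_of_irrational_ratio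
      (P := fun a => ∀ s < 0, ∀ y : E3, W s y = Real.exp a • W (Real.exp a ^ 2 * s) (Real.exp a • y))
      ?_ ?_ ?_ ?_ ?_ ?_ hirr
    · intro s hs y
      simp
    · intro a b ha hb s hs y
      have hs' : Real.exp a ^ 2 * s < 0 := mul_neg_of_pos_of_neg (pow_pos (Real.exp_pos a) 2) hs
      rw [ha s hs y, hb _ hs' (Real.exp a • y), smul_smul, smul_smul, Real.exp_add]
      have e1 : Real.exp b ^ 2 * (Real.exp a ^ 2 * s) = (Real.exp a * Real.exp b) ^ 2 * s := by ring
      have e2 : Real.exp b * Real.exp a = Real.exp a * Real.exp b := mul_comm _ _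
      rw [e1, e2]
    · intro a ha s hs y
      have hs' : Real.exp (-a) ^ 2 * s < 0 := mul_neg_of_pos_of_neg (pow_pos (Real.exp_pos (-a)) 2) hs
      have hrel := ha _ hs' (Real.exp (-a) • y)
      have e1 : Real.exp a ^ 2 * (Real.exp (-a) ^ 2 * s) = s := by
        rw [← mul_assoc, ← mul_pow, ← Real.exp_add, add_neg_cancel, Real.exp_zero, one_pow, one_mul]
      have e2 : Real.exp a • Real.exp (-a) • y = y := by
        rw [smul_smul, ← Real.exp_add, add_neg_cancel, Real.exp_zero, one_smul]
      rw [e1, e2] at hrel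
      rw [hrel, smul_smul, ← Real.exp_add, neg_add_cancel, Real.exp_zero, one_smul]
    · have hset : {a : ℝ | ∀ s < 0, ∀ y : E3, W s y = Real.exp a • W (Real.exp a ^ 2 * s) (Real.exp a • y)} =
          ⋂ (s : ℝ) (_ : s < 0) (y : E3), {a : ℝ | W s y = Real.exp a • W (Real.exp a ^ 2 * s) (Real.exp a • y)} := by
        ext a
        simp only [mem_setOf_eq, mem_iInter]
      rw [hset]
      refine isClosed_iInter fun s => isClosed_iInter fun hs => isClosed_iInter fun y => ?_
      have hcurve : Continuous fun a : ℝ => ((Real.exp a ^ 2 * s, Real.exp a • y) : ℝ × E3) :=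
        ((Real.continuous_exp.pow 2).mul continuous_const).prodMk (Real.continuous_exp.smul continuous_const)
      have hmaps : ∀ a : ℝ, ((Real.exp a ^ 2 * s, Real.exp a • y) : ℝ × E3) ∈ Iio (0 : ℝ) ×ˢ (univ : Set E3) := fun a =>
        ⟨mul_neg_of_pos_of_neg (pow_pos (Real.exp_pos a) 2) hs, mem_univ _⟩
      have hcomp : Continuous fun a : ℝ => W (Real.exp a ^ 2 * s) (Real.exp a • y) :=
        hW.continuousOn_uncurry.comp_continuous hcurve hmaps
      exact isClosed_eq continuous_const (Real.continuous_exp.smul hcomp)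
    · intro s hs y
      rw [Real.exp_log hlam]
      exact h s hs y
    · intro s hs y
      rw [Real.exp_log hlam']
      exact h' s hs y
  intro μ hμ s hs y
  have := key (Real.log μ) s hs y
  rw [Real.exp_log hμ] at this
  exact this.symm

/-- **(KD) A DSS WINDOW FOR TWO INCOMMENSURABLE FACTORS KILLS.**  `W ∈ 𝒦_M`, an apex `b`, a radius `a > 0`, a window depth `K > 1`,
factors `λ, λ' > 0` with `log λ / log λ'` IRRATIONAL, and both DSS relations on `[−K, −1] × B(b, a)`.  Then `W ≡ 0`
(point + time continuation, closed-subgroup dichotomy, Tsai's theorem BY NAME).  ONE factor (or commensurable factors) is the OPEN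
backward-DSS scenario and is NOT claimed (§1 boundary). -/
theorem eq_zero_of_dssPair {M : ℝ} {W : ℝ → E3 → E3} (hW : IsTypeIAncientMild M W) (b : E3) {a K lam lam' : ℝ} (ha : 0 < a)
    (hK : 1 < K) (hlam : 0 < lam) (hlam' : 0 < lam') (hirr : Irrational (Real.log lam / Real.log lam'))
    (hd : ∀ s ∈ Icc (-K) (-1), ∀ w ∈ ball (0 : E3) a, W s (b + w) = lam • W (lam ^ 2 * s) (b + lam • w))
    (hd' : ∀ s ∈ Icc (-K) (-1), ∀ w ∈ ball (0 : E3) a, W s (b + w) = lam' • W (lam' ^ 2 * s) (b + lam' • w)) :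
    ∀ s < 0, ∀ y : E3, W s y = 0 := by
  have hV : IsTypeIAncientMild M (fun s y => W s (y + b)) := IsTypeIAncientMild.comp_add_right hW b
  have hspace : ∀ {l : ℝ}, 0 < l →
      (∀ s ∈ Icc (-K) (-1), ∀ w ∈ ball (0 : E3) a, W s (b + w) = l • W (l ^ 2 * s) (b + l • w)) →
      ∀ s ∈ Icc (-K) (-1), ∀ w : E3,
        (fun s y => W s (y + b)) s w = l • (fun s y => W s (y + b)) (l ^ 2 * s) (l • w) := by
    intro l hl hrel s hs
    have hs0 : s < 0 := by linarith [hs.2]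
    have hσ : l ^ 2 * s < 0 := mul_neg_of_pos_of_neg (pow_pos hl 2) hs0
    refine rel_all_of_ball hV hs0 hσ ha l l fun w hw => ?_
    show W s (w + b) = l • W (l ^ 2 * s) (l • w + b)
    rw [add_comm w b, add_comm (l • w) b]
    exact hrel s hs w hw
  have h1 := dss_allTimes hV hK hlam (hspace hlam hd)
  have h2 := dss_allTimes hV hK hlam' (hspace hlam' hd')
  have hsc := scaleInvariant_of_two hV hlam hlam' hirr h1 h2
  have hz := PoloidalWindowDoorPoloidalWindowRigidityStrata.eq_zero_of_scaleInvariant hV.hasTypeITimeDecay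
    hV.continuousOn_uncurry (fun s t hst ht x => hV.mild_eq_heatExtension hst ht x) (fun t ht => hV.isDivFree ht) hsc
  intro s hs y
  have := hz s hs (y - b)
  simpa using this

/-- **Dilation continuation.** `W(−1, w) = μ • W(−1, μ•w)` for all `w` and all `μ` in a non-degenerate interval `[μ₁, μ₂]` ⇒ for
every `μ > 0` (slice analyticity along `μ ↦ μ•w`, identity theorem on `ℝ`; no sign condition on the interval). -/
theorem hom_allScales {M : ℝ} {W : ℝ → E3 → E3} (hW : IsTypeIAncientMild M W) {μ₁ μ₂ : ℝ} (h12 : μ₁ < μ₂)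
    (h : ∀ μ ∈ Icc μ₁ μ₂, ∀ w : E3, W (-1) w = μ • W (-1) (μ • w)) :
    ∀ μ : ℝ, 0 < μ → ∀ w : E3, W (-1) w = μ • W (-1) (μ • w) := by
  intro μ hμ w
  have hslice : AnalyticOnNhd ℝ (W (-1)) univ := hW.analyticOnNhd_slice_univ (by norm_num)
  have hφ : AnalyticOnNhd ℝ (fun μ : ℝ => μ • W (-1) (μ • w) - W (-1) w) univ := by
    intro μ _
    have hlin : AnalyticAt ℝ (fun μ : ℝ => μ • w) μ := analyticAt_id.fun_smul analyticAt_const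
    have hc : AnalyticAt ℝ (fun μ : ℝ => W (-1) (μ • w)) μ :=
      AnalyticAt.comp (g := W (-1)) (f := fun μ : ℝ => μ • w) (x := μ) (hslice _ (mem_univ _)) hlin
    exact (analyticAt_id.fun_smul hc).fun_sub analyticAt_const
  have hev : (fun μ : ℝ => μ • W (-1) (μ • w) - W (-1) w) =ᶠ[𝓝 ((μ₁ + μ₂) / 2)] 0 := by
    filter_upwards [Ioo_mem_nhds (show μ₁ < (μ₁ + μ₂) / 2 by linarith) (show (μ₁ + μ₂) / 2 < μ₂ by linarith)] with μ hμ
    simp only [Pi.zero_apply]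
    rw [← h μ ⟨hμ.1.le, hμ.2.le⟩ w]
    exact sub_self _
  have hzero := hφ.eqOn_zero_of_preconnected_of_eventuallyEq_zero isPreconnected_univ (mem_univ _) hev
  have h0 : μ • W (-1) (μ • w) - W (-1) w = 0 := hzero (mem_univ μ)
  exact (sub_eq_zero.1 h0).symm

/-- **(KH) A HOMOGENEOUS SNAPSHOT OVER A RANGE OF DILATIONS KILLS.**  `W ∈ 𝒦_M`, an apex `b`, `a > 0`, `μ₁ < μ₂`, and
`μ • W(−1, b + μ•w) = W(−1, b + w)` for `μ ∈ [μ₁, μ₂]`, `‖w‖ < a` (the snapshot is `(−1)`-homogeneous about `b` over a range of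
dilations).  Then `W ≡ 0` (point + dilation continuation, tree `eq_zero_of_homogeneous_slice` BY NAME). -/
theorem eq_zero_of_homogeneous {M : ℝ} {W : ℝ → E3 → E3} (hW : IsTypeIAncientMild M W) (b : E3) {a μ₁ μ₂ : ℝ} (ha : 0 < a)
    (h12 : μ₁ < μ₂)
    (hhom : ∀ μ ∈ Icc μ₁ μ₂, ∀ w ∈ ball (0 : E3) a, μ • W (-1) (b + μ • w) = W (-1) (b + w)) :
    ∀ s < 0, ∀ y : E3, W s y = 0 := by
  have hV : IsTypeIAncientMild M (fun s y => W s (y + b)) := IsTypeIAncientMild.comp_add_right hW b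
  have hall : ∀ μ ∈ Icc μ₁ μ₂, ∀ w : E3,
      (fun s y => W s (y + b)) (-1) w = μ • (fun s y => W s (y + b)) (-1) (μ • w) := by
    intro μ hμ
    refine rel_all_of_ball hV (by norm_num) (by norm_num) ha μ μ fun w hw => ?_
    show W (-1) (w + b) = μ • W (-1) (μ • w + b)
    rw [add_comm w b, add_comm (μ • w) b]
    exact (hhom μ hμ w hw).symm
  have hsc := hom_allScales hV h12 hall
  have hh : ∀ lam : ℝ, 0 < lam → ∀ w : E3,
      (fun s y => W s (y + b)) (-1) ((0 : E3) + lam • w) = lam⁻¹ • (fun s y => W s (y + b)) (-1) ((0 : E3) + w) := by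
    intro lam hlam w
    beta_reduce
    rw [zero_add, zero_add, hsc lam hlam w, inv_smul_smul₀ hlam.ne']
  have hz := eq_zero_of_homogeneous_slice hV.hasTypeITimeDecay hV.continuousOn_uncurry
    (fun s t hst ht x => hV.mild_eq_heatExtension hst ht x) (fun t ht => hV.isDivFree ht) (show (-1 : ℝ) < 0 by norm_num)
    (0 : E3) hh
  intro s hs y
  have := hz s hs (y - b)
  simpa using this

/-! ### Limits with a MOVING APEX; the three defects; the three LEVELS (socket of §2 + limit + kill) -/

/-- Evaluating a locally uniformly convergent sequence of slices along a subsequence and a convergent sequence of points. -/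
theorem tendsto_eval {F : ℕ → E3 → E3} {f : E3 → E3} (h : TendstoLocallyUniformly F f atTop) (hf : Continuous f)
    {ψ : ℕ → ℕ} (hψ : StrictMono ψ) {p : ℕ → E3} {p₀ : E3} (hp : Tendsto p atTop (𝓝 p₀)) :
    Tendsto (fun j => F (ψ j) (p j)) atTop (𝓝 (f p₀)) :=
  by
    have h' : TendstoLocallyUniformly (fun j => F (ψ j)) f atTop := fun v hv z => by
      obtain ⟨t, ht, hev⟩ := h v hv z
      exact ⟨t, ht, hψ.tendsto_atTop.eventually hev⟩
    exact h'.tendsto_comp hf.continuousAt hp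

/-- The **similar defect below `Λ`** of `W` (factor range `[l₁, l₂]`, apex reach `A`, radius `a`): an apex `b`, `‖b‖ ≤ A`, with
`‖W(−1, b + w) − λ • W(−λ², b + λ•w)‖ ≤ Λ` for `λ ∈ [l₁, l₂]`, `‖w‖ ≤ a`. -/
def SimilarDefectBelow (l₁ l₂ A a Λ : ℝ) (W : ℝ → E3 → E3) : Prop :=
  ∃ b ∈ closedBall (0 : E3) A, ∀ lam ∈ Icc l₁ l₂, ∀ w ∈ closedBall (0 : E3) a,
    ‖W (-1) (b + w) - lam • W (-lam ^ 2) (b + lam • w)‖ ≤ Λ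

/-- **Similar limit** (moving apex): similar defects `≤ δ_j` of fields `F_j` converging locally uniformly on slices to `W` (continuous
slices), `δ_j → δ₀`, give a similar defect `≤ δ₀` of `W` (compactness of the apex ball, `tendsto_eval`). -/
theorem similar_limit {l₁ l₂ A a : ℝ} (hl₁ : 0 < l₁) {F : ℕ → ℝ → E3 → E3} {W : ℝ → E3 → E3}
    (hWc : ∀ s < 0, Continuous (W s)) (hlu : ∀ s < 0, TendstoLocallyUniformly (fun j => F j s) (W s) atTop)
    {δ : ℕ → ℝ} {δ₀ : ℝ} (hδ : Tendsto δ atTop (𝓝 δ₀))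
    (hdef : ∀ j, ∃ b ∈ closedBall (0 : E3) A, ∀ lam ∈ Icc l₁ l₂, ∀ w ∈ closedBall (0 : E3) a,
      ‖F j (-1) (b + w) - lam • F j (-lam ^ 2) (b + lam • w)‖ ≤ δ j) :
    SimilarDefectBelow l₁ l₂ A a δ₀ W := by
  choose b hb hdefb using hdef
  obtain ⟨b₀, hb₀, ψ, hψ, hlim⟩ := (isCompact_closedBall (0 : E3) A).tendsto_subseq hb
  refine ⟨b₀, hb₀, fun lam hlam w hw => ?_⟩
  have hl : 0 < lam := hl₁.trans_le hlam.1
  have hσ : -lam ^ 2 < (0 : ℝ) := by have := pow_pos hl 2; linarith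
  have h1 : Tendsto (fun j => F (ψ j) (-1) (b (ψ j) + w)) atTop (𝓝 (W (-1) (b₀ + w))) :=
    tendsto_eval (hlu (-1) (by norm_num)) (hWc (-1) (by norm_num)) hψ (hlim.add tendsto_const_nhds)
  have h2 : Tendsto (fun j => F (ψ j) (-lam ^ 2) (b (ψ j) + lam • w)) atTop (𝓝 (W (-lam ^ 2) (b₀ + lam • w))) :=
    tendsto_eval (hlu _ hσ) (hWc _ hσ) hψ (hlim.add tendsto_const_nhds)
  exact le_of_tendsto_of_tendsto (h1.sub (h2.const_smul lam)).norm (hδ.comp hψ.tendsto_atTop)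
    (Eventually.of_forall fun j => hdefb (ψ j) lam hlam w hw)

/-- **THE SIMILAR LEVEL `Λ₁(M, l₁, l₂, A, a, κ)`**: no `W ∈ 𝒦_M` with `‖W(−1, 0)‖ ≥ κ` has similar defect below `Λ₁` (socket + similar
limit + (KS)). -/
theorem exists_similarLevel (M l₁ l₂ A a : ℝ) (hl₁ : 0 < l₁) (hl : l₁ < l₂) (ha : 0 < a) {κ : ℝ} (hκ : 0 < κ) :
    ∃ Λ₁ : ℝ, 0 < Λ₁ ∧ ∀ W : ℝ → E3 → E3, IsTypeIAncientMild M W → κ ≤ ‖W (-1) 0‖ →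
      ¬ SimilarDefectBelow l₁ l₂ A a Λ₁ W := by
  refine NeedleTop.exists_level_of_limitKill M hκ (SimilarDefectBelow l₁ l₂ A a) ?_
  intro Wn W ε _ hεlim _ hW hP _ _ hlu
  obtain ⟨b, -, hb⟩ := similar_limit hl₁ (fun s hs => continuous_slice' hW hs) hlu hεlim hP
  have hrel : ∀ lam ∈ Icc l₁ l₂, ∀ w ∈ ball (0 : E3) a, W (-1) (b + w) = lam • W (-lam ^ 2) (b + lam • w) := by
    intro lam hlam w hw
    have h0 := hb lam hlam w (ball_subset_closedBall hw)
    exact sub_eq_zero.1 (norm_le_zero_iff.1 h0)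
  exact eq_zero_of_similar hW b ha hl₁ hl hrel (-1) (by norm_num) 0

/-- The **DSS-pair defect below `Λ`** of `W` (factors `λ, λ'`, depth `K`, apex reach `A`, radius `a`). -/
def DssDefectBelow (lam lam' K A a Λ : ℝ) (W : ℝ → E3 → E3) : Prop :=
  ∃ b ∈ closedBall (0 : E3) A, ∀ s ∈ Icc (-K) (-1), ∀ w ∈ closedBall (0 : E3) a,
    ‖W s (b + w) - lam • W (lam ^ 2 * s) (b + lam • w)‖ ≤ Λ ∧
    ‖W s (b + w) - lam' • W (lam' ^ 2 * s) (b + lam' • w)‖ ≤ Λ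

/-- **DSS limit** (moving apex). -/
theorem dss_limit {lam lam' K A a : ℝ} (hlam : 0 < lam) (hlam' : 0 < lam') {F : ℕ → ℝ → E3 → E3} {W : ℝ → E3 → E3}
    (hWc : ∀ s < 0, Continuous (W s)) (hlu : ∀ s < 0, TendstoLocallyUniformly (fun j => F j s) (W s) atTop)
    {δ : ℕ → ℝ} {δ₀ : ℝ} (hδ : Tendsto δ atTop (𝓝 δ₀))
    (hdef : ∀ j, ∃ b ∈ closedBall (0 : E3) A, ∀ s ∈ Icc (-K) (-1), ∀ w ∈ closedBall (0 : E3) a,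
      ‖F j s (b + w) - lam • F j (lam ^ 2 * s) (b + lam • w)‖ ≤ δ j ∧
      ‖F j s (b + w) - lam' • F j (lam' ^ 2 * s) (b + lam' • w)‖ ≤ δ j) :
    DssDefectBelow lam lam' K A a δ₀ W := by
  choose b hb hdefb using hdef
  obtain ⟨b₀, hb₀, ψ, hψ, hlim⟩ := (isCompact_closedBall (0 : E3) A).tendsto_subseq hb
  refine ⟨b₀, hb₀, fun s hs w hw => ?_⟩
  have hs0 : s < 0 := by linarith [hs.2]
  have key : ∀ {l : ℝ}, 0 < l → (∀ j, ‖F j s (b j + w) - l • F j (l ^ 2 * s) (b j + l • w)‖ ≤ δ j) →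
      ‖W s (b₀ + w) - l • W (l ^ 2 * s) (b₀ + l • w)‖ ≤ δ₀ := by
    intro l hl hj
    have hσ : l ^ 2 * s < 0 := mul_neg_of_pos_of_neg (pow_pos hl 2) hs0
    have h1 : Tendsto (fun j => F (ψ j) s (b (ψ j) + w)) atTop (𝓝 (W s (b₀ + w))) :=
      tendsto_eval (hlu s hs0) (hWc s hs0) hψ (hlim.add tendsto_const_nhds)
    have h2 : Tendsto (fun j => F (ψ j) (l ^ 2 * s) (b (ψ j) + l • w)) atTop (𝓝 (W (l ^ 2 * s) (b₀ + l • w))) :=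
      tendsto_eval (hlu _ hσ) (hWc _ hσ) hψ (hlim.add tendsto_const_nhds)
    exact le_of_tendsto_of_tendsto (h1.sub (h2.const_smul l)).norm (hδ.comp hψ.tendsto_atTop)
      (Eventually.of_forall fun j => hj (ψ j))
  exact ⟨key hlam fun j => (hdefb j s hs w hw).1, key hlam' fun j => (hdefb j s hs w hw).2⟩

/-- **THE DSS-PAIR LEVEL** (socket + DSS limit + (KD)); factors `λ, λ' > 0` with `log λ / log λ'` irrational, depth `K > 1`. -/
theorem exists_dssLevel (M lam lam' K A a : ℝ) (hlam : 0 < lam) (hlam' : 0 < lam')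
    (hirr : Irrational (Real.log lam / Real.log lam')) (hK : 1 < K) (ha : 0 < a) {κ : ℝ} (hκ : 0 < κ) :
    ∃ Λ₁ : ℝ, 0 < Λ₁ ∧ ∀ W : ℝ → E3 → E3, IsTypeIAncientMild M W → κ ≤ ‖W (-1) 0‖ →
      ¬ DssDefectBelow lam lam' K A a Λ₁ W := by
  refine NeedleTop.exists_level_of_limitKill M hκ (DssDefectBelow lam lam' K A a) ?_
  intro Wn W ε _ hεlim _ hW hP _ _ hlu
  obtain ⟨b, -, hb⟩ := dss_limit hlam hlam' (fun s hs => continuous_slice' hW hs) hlu hεlim hP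
  have hrel : ∀ s ∈ Icc (-K) (-1), ∀ w ∈ ball (0 : E3) a, W s (b + w) = lam • W (lam ^ 2 * s) (b + lam • w) := by
    intro s hs w hw
    exact sub_eq_zero.1 (norm_le_zero_iff.1 (hb s hs w (ball_subset_closedBall hw)).1)
  have hrel' : ∀ s ∈ Icc (-K) (-1), ∀ w ∈ ball (0 : E3) a, W s (b + w) = lam' • W (lam' ^ 2 * s) (b + lam' • w) := by
    intro s hs w hw
    exact sub_eq_zero.1 (norm_le_zero_iff.1 (hb s hs w (ball_subset_closedBall hw)).2)
  exact eq_zero_of_dssPair hW b ha hK hlam hlam' hirr hrel hrel' (-1) (by norm_num) 0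

/-- The **homogeneity defect below `Λ`** of `W` on the slice `−1` (dilation range `[μ₁, μ₂]`, apex reach `A`, radius `a`). -/
def HomDefectBelow (μ₁ μ₂ A a Λ : ℝ) (W : ℝ → E3 → E3) : Prop :=
  ∃ b ∈ closedBall (0 : E3) A, ∀ μ ∈ Icc μ₁ μ₂, ∀ w ∈ closedBall (0 : E3) a,
    ‖μ • W (-1) (b + μ • w) - W (-1) (b + w)‖ ≤ Λ

/-- **Homogeneity limit** (moving apex; slice `−1` only). -/
theorem hom_limit {μ₁ μ₂ A a : ℝ} {F : ℕ → ℝ → E3 → E3} {W : ℝ → E3 → E3}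
    (hWc : Continuous (W (-1))) (hlu : TendstoLocallyUniformly (fun j => F j (-1)) (W (-1)) atTop)
    {δ : ℕ → ℝ} {δ₀ : ℝ} (hδ : Tendsto δ atTop (𝓝 δ₀))
    (hdef : ∀ j, ∃ b ∈ closedBall (0 : E3) A, ∀ μ ∈ Icc μ₁ μ₂, ∀ w ∈ closedBall (0 : E3) a,
      ‖μ • F j (-1) (b + μ • w) - F j (-1) (b + w)‖ ≤ δ j) :
    HomDefectBelow μ₁ μ₂ A a δ₀ W := by
  choose b hb hdefb using hdef
  obtain ⟨b₀, hb₀, ψ, hψ, hlim⟩ := (isCompact_closedBall (0 : E3) A).tendsto_subseq hb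
  refine ⟨b₀, hb₀, fun μ hμ w hw => ?_⟩
  have h1 : Tendsto (fun j => F (ψ j) (-1) (b (ψ j) + μ • w)) atTop (𝓝 (W (-1) (b₀ + μ • w))) :=
    tendsto_eval hlu hWc hψ (hlim.add tendsto_const_nhds)
  have h2 : Tendsto (fun j => F (ψ j) (-1) (b (ψ j) + w)) atTop (𝓝 (W (-1) (b₀ + w))) :=
    tendsto_eval hlu hWc hψ (hlim.add tendsto_const_nhds)
  exact le_of_tendsto_of_tendsto ((h1.const_smul μ).sub h2).norm (hδ.comp hψ.tendsto_atTop)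
    (Eventually.of_forall fun j => hdefb (ψ j) μ hμ w hw)

/-- **THE HOMOGENEITY LEVEL** (socket + homogeneity limit + (KH)); dilation range `μ₁ < μ₂`, no sign condition. -/
theorem exists_homLevel (M μ₁ μ₂ A a : ℝ) (hμ : μ₁ < μ₂) (ha : 0 < a) {κ : ℝ} (hκ : 0 < κ) :
    ∃ Λ₁ : ℝ, 0 < Λ₁ ∧ ∀ W : ℝ → E3 → E3, IsTypeIAncientMild M W → κ ≤ ‖W (-1) 0‖ →
      ¬ HomDefectBelow μ₁ μ₂ A a Λ₁ W := by
  refine NeedleTop.exists_level_of_limitKill M hκ (HomDefectBelow μ₁ μ₂ A a) ?_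
  intro Wn W ε _ hεlim _ hW hP _ _ hlu
  obtain ⟨b, -, hb⟩ := hom_limit (continuous_slice' hW (by norm_num)) (hlu (-1) (by norm_num)) hεlim hP
  have hrel : ∀ μ ∈ Icc μ₁ μ₂, ∀ w ∈ ball (0 : E3) a, μ • W (-1) (b + μ • w) = W (-1) (b + w) := by
    intro μ hμ w hw
    exact sub_eq_zero.1 (norm_le_zero_iff.1 (hb μ hμ w (ball_subset_closedBall hw)))
  exact eq_zero_of_homogeneous hW b ha hμ hrel (-1) (by norm_num) 0

end Summit.NavierStokesRegularity.NavierStokesRegularity.Theorems.ScenarioCensus.ScalingTop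

end
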